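import Summits.QuantumFields.BalabanUV.T4Continuum.Support.RegionTaylorColumns

/-!
# T⁴ programme, spine node NE2 (U1a), sub-row Δ1 — THE GRADED WELL, leaf (GW-B) part 1: THE «H⁻¹ ROUTE» ON THE TORUS — the fine
# GRADIENT of the solution of a massive scalar torus equation with PLANTED data against King's planting of the coarse gradient:
# `‖∂′·G′·J₀ − J·∂·G‖ ≤ Ccol·N⁻¹` whenever the masses intertwine exactly (`W′J₀ = J₀W`) — rate `N⁻¹`, no wall, no trace
# (owner item O17-b, ruling R51 (c); the abstract half — the graded-well instance `hB` is part 2)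

Row NE2 OWNER (unit `b2b-balaban-t4-ne2-p1`, gen 17).  Leaf (GW-B) of the graded-well END (`GradedWellSandwichLaw.towerLimitRate_GW_of_GWB`,
leaf-06-g8; owner R50/R51) asks for `‖BhGWL k − J_k·BhGW k‖ ≤ Cb·θ^k`, `BhGW k = ∂·G′_GW·QsGWnᴴ`: the fine gradient field of the graded
scalar potential with lifted block data against the planted coarse gradient field.  The electric towers proved the same estimate on COORDINATE
BOXES at rate `n^{−1/2}` (leaf-05-g9, `RegionGaugeColumnsTwoLevel`, route «H⁻¹»: cellwise Taylor planting + the divergence flux, the loss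
being the low-wall leak).  On the TORUS there is no wall: THIS FILE runs the same route with leaf-05-g9's torus lattice calculus
(`CellTaylorPlanting` B1: `taylorJ`, `GradOp_taylorJ_sub_JK_GradOp`, `norm_sq_mul_nsq_GradOp_taylorJ_sub_le`, `norm_sq_mul_nsq_taylorJ_sub_JK0_le`;
`CellDivergencePlanting` B2: `fluxJ`, `GradOp_conjTranspose_JK_sub_JK0_apply`, `nsq_fluxJ_le`; B3a's torus identity `norm_GradOp_backDiff_eq`)
and gan24's discrete `H²` identity on the WHOLE torus (`DirichletBoxRegularity.sum_normSq_LapS_eq` at `Ω = univ`: `Σ|Δψ|² = Hdiag + Hmixed`),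
for an ABSTRACT pair of massive scalar operators `D = Δ_N + W`, `D′ = Δ_{L·N} + W′` (`Δ = ∂ᴴ∂`, `W′ ⪰ 0`) whose masses INTERTWINE EXACTLY
with King's scalar planting, `W′·J₀ = J₀·W` (for the graded well: leaf-05-g10's `GradedWellGramPairing.QwHQw_succ_mul_J0`):

 * §1 energy tools: `nsq (∂v) ≤ Re⟨v, D′v⟩`, `‖∂·G‖ ≤ √‖G‖` (`sqrt_nsq_grad_inv_le`), `‖∂·G·∂ᴴ‖ ≤ 1` (`sqrt_nsq_grad_inv_gradH_le`);
 * §2 the three planting defects against `‖Δψ‖` / `‖∂ψ‖` on the torus: `‖∂′(Tψ) − J(∂ψ)‖ ≤ √d·L·N⁻¹·‖Δψ‖` (King's face term, MIXED Hessian),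
   `‖fluxJ (∂ψ)‖ ≤ N⁻¹·‖Δψ‖` (DIAGONAL Hessian), `‖(T − J₀)ψ‖ ≤ √d·N⁻¹·‖∂ψ‖`;
 * §3 the representation **`fine_taylor_identity`**: `D′(Tψ) = J₀(Dψ) + ∂′ᴴ(g + h) + W′((T − J₀)ψ)` and the END
   **`sqrt_nsq_columns_twoLevel_le`**: `‖∂′(G′(J₀f)) − J(∂(Gf))‖ ≤ Ccol·N⁻¹·‖f‖`,
   `Ccol d L g g′ w w′ := (2√d·L + 1)·(1 + w·g) + √g′·w′·√d·√g` (`‖G‖ ≤ g`, `‖G′‖ ≤ g′`, `‖W‖ ≤ w`, `‖W′‖ ≤ w′`), operator form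
   **`opNorm_columns_twoLevel_le`**: `‖∂′·G′·J₀ − J·(∂·G)‖ ≤ Ccol·N⁻¹`.

HONEST FRAMING (T4-DAG p. 1).  [folklore] lattice bookkeeping on a finite torus over landed modules; statements and constants OURS; `U = 1`;
two adjacent torus levels; model level when consumed; (GW-B) itself is part 2; NE2 (U1a) NOT proved; spine PROVED 0/9 unchanged; NOT [B9]
(3.16)/(3.23)–(3.27)/(3.42) as printed; NOT infinite volume / mass gap / Clay.  HONEST DEPENDENCY: continuum YM on T⁴ ⇐ BetaPertH ∧ nine spine
estimates (0/9 proved); BetaPertH ⇐ (D1) ∧ (D4) ∧ CAP+tail; G-an2-4 gates asym, D1 and NE2/3/4.  No `sorry`.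
-/

noncomputable section

open scoped BigOperators ComplexConjugate Matrix Matrix.Norms.L2Operator
open Finset

namespace Summit.QuantumFields.BalabanUV.T4Continuum.TorusColumnsTwoLevel

open Literature.MathematicalPhysics.QuantumFieldTheory.Balaban1983to89.B5Prop11Plancherel (Tor fine unitVec)
open Literature.MathematicalPhysics.QuantumFieldTheory.Balaban1983to89.B5Prop11Lower (nsq nsq_nonneg)
open Literature.MathematicalPhysics.QuantumFieldTheory.Balaban1983to89.B5Action121 (GradOp LapS GradOp_conjTranspose_mul_GradOp
  star_mulVec_dotProduct)
open Summit.QuantumFields.BalabanUV.T4Continuum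
open Summit.QuantumFields.BalabanUV.T4Continuum.KingPairingPlantedLaw (JK)
open Summit.QuantumFields.BalabanUV.T4Continuum.ScalarBlockPlanting (JK0)
open Summit.QuantumFields.BalabanUV.T4Continuum.ScalarAveragedPropagator (re_star_dotProduct_le opNorm_le_of_nsq_le_rect)
open Summit.QuantumFields.BalabanUV.T4Continuum.RegionGaugeSlice (form_gram re_form_le_opNorm)
open Summit.QuantumFields.BalabanUV.T4Continuum.RegionNormPairingTools (sqrt_nsq_mulVec_le)
open Summit.QuantumFields.BalabanUV.T4Continuum.DirichletDirectionalBesov (sqrt_nsq_add_le sqrt_nsq_sub_le nsq_neg)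
open Summit.QuantumFields.BalabanUV.T4Continuum.CellTaylorPlanting (taylorJ GradOp_taylorJ_sub_JK_GradOp
  norm_sq_mul_nsq_GradOp_taylorJ_sub_le norm_sq_mul_nsq_taylorJ_sub_JK0_le)
open Summit.QuantumFields.BalabanUV.T4Continuum.CellDivergencePlanting (fluxJ GradOp_conjTranspose_JK_sub_JK0_apply nsq_fluxJ_le)
open Summit.QuantumFields.BalabanUV.T4Continuum.RegionTaylorColumns (norm_GradOp_backDiff_eq)
open Summit.QuantumFields.BalabanUV.Beta.GAN24.DirichletBoxRegularity (Pdir Hdiag Hmixed hdiag_nonneg hmixed_nonneg sum_normSq_LapS_eq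
  CornerFree SuppIn)

variable {d : ℕ}

/-! ## §1 Energy tools for `D = ∂ᴴ∂ + W` with `W ⪰ 0` -/

section Energy

variable {α β : Type*} [Fintype α] [DecidableEq α] [Fintype β] [DecidableEq β]

/-- `√nsq v ≤ c·√nsq w` from `nsq v ≤ Re⟨v′, w⟩`-type self-bounds: if `t ≤ √t·s` with `0 ≤ s` then `√t ≤ s`. [folklore] -/
theorem sqrt_le_of_le_sqrt_mul {t s : ℝ} (ht : 0 ≤ t) (hs : 0 ≤ s) (h : t ≤ Real.sqrt t * s) : Real.sqrt t ≤ s := by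
  by_cases hz : Real.sqrt t = 0
  · rw [hz]; exact hs
  · have hpos : 0 < Real.sqrt t := lt_of_le_of_ne (Real.sqrt_nonneg _) (Ne.symm hz)
    have h2 : Real.sqrt t * Real.sqrt t ≤ Real.sqrt t * s := by rw [Real.mul_self_sqrt ht]; exact h
    exact le_of_mul_le_mul_left h2 hpos

omit [DecidableEq α] [DecidableEq β] in
/-- `nsq (∂v) ≤ Re⟨v, (∂ᴴ∂ + W)v⟩` for `W ⪰ 0`. [folklore] -/
theorem nsq_grad_le_form (Dg : Matrix β α ℂ) (W : Matrix α α ℂ) (hW : ∀ v, 0 ≤ (star v ⬝ᵥ (W *ᵥ v)).re) (v : α → ℂ) :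
    nsq (Dg *ᵥ v) ≤ (star v ⬝ᵥ ((Dgᴴ * Dg + W) *ᵥ v)).re := by
  rw [Matrix.add_mulVec, dotProduct_add, Complex.add_re, form_gram, Complex.ofReal_re]
  have := hW v
  linarith

omit [DecidableEq β] in
/-- **`‖∂·G x‖ ≤ √‖G‖·‖x‖`** (`D·G = 1`, `nsq (∂v) ≤ Re⟨v, Dv⟩`). [folklore] -/
theorem sqrt_nsq_grad_inv_le (Dg : Matrix β α ℂ) {D G : Matrix α α ℂ} (hDG : D * G = 1)
    (hform : ∀ v, nsq (Dg *ᵥ v) ≤ (star v ⬝ᵥ (D *ᵥ v)).re) (x : α → ℂ) :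
    Real.sqrt (nsq (Dg *ᵥ (G *ᵥ x))) ≤ Real.sqrt ‖G‖ * Real.sqrt (nsq x) := by
  have h1 := hform (G *ᵥ x)
  have e0 : D *ᵥ (G *ᵥ x) = x := by rw [Matrix.mulVec_mulVec, hDG, Matrix.one_mulVec]
  rw [e0] at h1
  have h2 : (star (G *ᵥ x) ⬝ᵥ x).re ≤ ‖G‖ * nsq x := re_form_le_opNorm G x
  rw [← Real.sqrt_mul_self (mul_nonneg (Real.sqrt_nonneg ‖G‖) (Real.sqrt_nonneg (nsq x))), mul_mul_mul_comm,
    Real.mul_self_sqrt (norm_nonneg _), Real.mul_self_sqrt (nsq_nonneg _)]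
  exact Real.sqrt_le_sqrt (h1.trans h2)

omit [DecidableEq β] in
/-- operator form: `‖∂·G‖ ≤ √‖G‖`. [folklore] -/
theorem opNorm_grad_inv_le (Dg : Matrix β α ℂ) {D G : Matrix α α ℂ} (hDG : D * G = 1)
    (hform : ∀ v, nsq (Dg *ᵥ v) ≤ (star v ⬝ᵥ (D *ᵥ v)).re) : ‖Dg * G‖ ≤ Real.sqrt ‖G‖ := by
  refine opNorm_le_of_nsq_le_rect _ (Real.sqrt_nonneg _) fun x => ?_
  have h := sqrt_nsq_grad_inv_le Dg hDG hform x
  rw [← Matrix.mulVec_mulVec]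
  have h2 := mul_self_le_mul_self (Real.sqrt_nonneg _) h
  rw [Real.mul_self_sqrt (nsq_nonneg _), mul_mul_mul_comm, Real.mul_self_sqrt (nsq_nonneg _), ← sq] at h2
  exact h2

omit [DecidableEq β] in
/-- **`‖∂·G·∂ᴴ y‖ ≤ ‖y‖`** (`D·G = 1`, `nsq (∂v) ≤ Re⟨v, Dv⟩`). [folklore] -/
theorem sqrt_nsq_grad_inv_gradH_le (Dg : Matrix β α ℂ) {D G : Matrix α α ℂ} (hDG : D * G = 1)
    (hform : ∀ v, nsq (Dg *ᵥ v) ≤ (star v ⬝ᵥ (D *ᵥ v)).re) (y : β → ℂ) :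
    Real.sqrt (nsq (Dg *ᵥ (G *ᵥ (Dgᴴ *ᵥ y)))) ≤ Real.sqrt (nsq y) := by
  set g := G *ᵥ (Dgᴴ *ᵥ y) with hg
  have h1 := hform g
  have e1 : D *ᵥ g = Dgᴴ *ᵥ y := by rw [hg, Matrix.mulVec_mulVec, hDG, Matrix.one_mulVec]
  rw [e1, ← star_mulVec_dotProduct] at h1
  exact sqrt_le_of_le_sqrt_mul (nsq_nonneg _) (Real.sqrt_nonneg _) (h1.trans (re_star_dotProduct_le _ y))

end Energy

/-! ## §2 The three planting defects on the torus, against `‖Δψ‖` and `‖∂ψ‖` -/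

section Defects

variable (N L : ℕ) [NeZero N] [NeZero L] (M : Fin d → ℕ) [hM : ∀ μ, NeZero (M μ)]

/-- the whole torus is corner-free and supports everything (gan24's hypotheses at `Ω = univ`). [folklore] -/
theorem cornerFree_univ : CornerFree (fine N M) (univ : Finset (Tor (fine N M))) ∧
    ∀ z : Tor (fine N M) → ℂ, SuppIn (fine N M) (univ : Finset (Tor (fine N M))) z :=
  ⟨fun x hx => absurd (mem_univ x) hx, fun _ x hx => absurd (mem_univ x) hx⟩

/-- **THE TORUS `H²` IDENTITY**: `nsq (Δψ) = Hdiag + Hmixed` (gan24's `sum_normSq_LapS_eq` at `Ω = univ`). [folklore] -/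
theorem nsq_LapS_eq (ψ : Tor (fine N M) → ℂ) :
    nsq (LapS (fine N M) (N : ℂ) *ᵥ ψ) = Hdiag (N : ℂ) univ ψ + Hmixed (N : ℂ) ψ := by
  rw [← sum_normSq_LapS_eq (cornerFree_univ N M).1 ((cornerFree_univ N M).2 ψ) (N : ℂ)]
  rfl

/-- **KING's FACE TERM**: `‖∂′(Tψ) − J(∂ψ)‖ ≤ √d·L·N⁻¹·‖Δψ‖`. [folklore] -/
theorem sqrt_nsq_gdef_le (ψ : Tor (fine N M) → ℂ) :
    Real.sqrt (nsq (GradOp (fine (L * N) M) ((L : ℂ) * (N : ℂ)) *ᵥ (taylorJ N L M *ᵥ ψ)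
        - JK N L M *ᵥ (GradOp (fine N M) (N : ℂ) *ᵥ ψ)))
      ≤ Real.sqrt d * L * (N : ℝ)⁻¹ * Real.sqrt (nsq (LapS (fine N M) (N : ℂ) *ᵥ ψ)) := by
  have hN : (0 : ℝ) < N := by exact_mod_cast Nat.pos_of_ne_zero (NeZero.ne N)
  have h := norm_sq_mul_nsq_GradOp_taylorJ_sub_le N L M (N : ℂ) ψ
  rw [Complex.norm_natCast] at h
  have hm : Hmixed (N : ℂ) ψ ≤ nsq (LapS (fine N M) (N : ℂ) *ᵥ ψ) := by
    rw [nsq_LapS_eq]; have := hdiag_nonneg (N : ℂ) univ ψ; linarith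
  have h2 : nsq (GradOp (fine (L * N) M) ((L : ℂ) * (N : ℂ)) *ᵥ (taylorJ N L M *ᵥ ψ) - JK N L M *ᵥ (GradOp (fine N M) (N : ℂ) *ᵥ ψ))
      ≤ (Real.sqrt d * L * (N : ℝ)⁻¹) ^ 2 * nsq (LapS (fine N M) (N : ℂ) *ᵥ ψ) := by
    rw [mul_pow, mul_pow, Real.sq_sqrt (Nat.cast_nonneg d), inv_pow]
    have h' : nsq (GradOp (fine (L * N) M) ((L : ℂ) * (N : ℂ)) *ᵥ (taylorJ N L M *ᵥ ψ) - JK N L M *ᵥ (GradOp (fine N M) (N : ℂ) *ᵥ ψ))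
        ≤ d * (L : ℝ) ^ 2 * Hmixed (N : ℂ) ψ / (N : ℝ) ^ 2 :=
      (le_div_iff₀ (pow_pos hN 2)).mpr (by rw [mul_comm]; exact h)
    calc _ ≤ d * (L : ℝ) ^ 2 * Hmixed (N : ℂ) ψ / (N : ℝ) ^ 2 := h'
      _ ≤ d * (L : ℝ) ^ 2 * nsq (LapS (fine N M) (N : ℂ) *ᵥ ψ) / (N : ℝ) ^ 2 := by gcongr
      _ = _ := by ring
  calc _ ≤ Real.sqrt ((Real.sqrt d * L * (N : ℝ)⁻¹) ^ 2 * nsq (LapS (fine N M) (N : ℂ) *ᵥ ψ)) := Real.sqrt_le_sqrt h2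
    _ = _ := by rw [Real.sqrt_mul (sq_nonneg _), Real.sqrt_sq (by positivity)]

/-- **THE DIVERGENCE FLUX**: `‖fluxJ (∂ψ)‖ ≤ N⁻¹·‖Δψ‖`. [folklore] -/
theorem sqrt_nsq_flux_le (ψ : Tor (fine N M) → ℂ) :
    Real.sqrt (nsq (fluxJ N L M (GradOp (fine N M) (N : ℂ) *ᵥ ψ)))
      ≤ (N : ℝ)⁻¹ * Real.sqrt (nsq (LapS (fine N M) (N : ℂ) *ᵥ ψ)) := by
  have hN : (0 : ℝ) < N := by exact_mod_cast Nat.pos_of_ne_zero (NeZero.ne N)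
  set U := GradOp (fine N M) (N : ℂ) *ᵥ ψ with hU
  have h1 := nsq_fluxJ_le N L M U
  have h2 : nsq (fun b : Tor (fine N M) × Fin d => U (b.1 - unitVec (fine N M) b.2, b.2) - U b)
      = ((N : ℝ)⁻¹) ^ 2 * Hdiag (N : ℂ) univ ψ := by
    unfold nsq Hdiag
    rw [Fintype.sum_prod_type, Finset.sum_comm, Finset.mul_sum]
    refine Finset.sum_congr rfl fun ν _ => ?_
    rw [Finset.mul_sum]
    refine Finset.sum_congr rfl fun x _ => ?_
    have e := norm_GradOp_backDiff_eq N M ψ x ν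
    show ‖U (x - unitVec (fine N M) ν, ν) - U (x, ν)‖ ^ 2 = _
    rw [hU, e, mul_pow]
  have hd : Hdiag (N : ℂ) univ ψ ≤ nsq (LapS (fine N M) (N : ℂ) *ᵥ ψ) := by
    rw [nsq_LapS_eq]; have := hmixed_nonneg (N : ℂ) ψ; linarith
  calc _ ≤ Real.sqrt (((N : ℝ)⁻¹) ^ 2 * nsq (LapS (fine N M) (N : ℂ) *ᵥ ψ)) := by
        refine Real.sqrt_le_sqrt (h1.trans ?_)
        rw [h2]; gcongr
    _ = _ := by rw [Real.sqrt_mul (sq_nonneg _), Real.sqrt_sq (inv_nonneg.mpr hN.le)]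

/-- **THE TAYLOR CORRECTION**: `‖(T − J₀)ψ‖ ≤ √d·N⁻¹·‖∂ψ‖`. [folklore] -/
theorem sqrt_nsq_taylor_sub_le (ψ : Tor (fine N M) → ℂ) :
    Real.sqrt (nsq ((taylorJ N L M - JK0 N L M) *ᵥ ψ))
      ≤ Real.sqrt d * (N : ℝ)⁻¹ * Real.sqrt (nsq (GradOp (fine N M) (N : ℂ) *ᵥ ψ)) := by
  have hN : (0 : ℝ) < N := by exact_mod_cast Nat.pos_of_ne_zero (NeZero.ne N)
  have h := norm_sq_mul_nsq_taylorJ_sub_JK0_le N L M (N : ℂ) ψ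
  rw [Complex.norm_natCast] at h
  have h2 : nsq ((taylorJ N L M - JK0 N L M) *ᵥ ψ) ≤ (Real.sqrt d * (N : ℝ)⁻¹) ^ 2 * nsq (GradOp (fine N M) (N : ℂ) *ᵥ ψ) := by
    rw [mul_pow, Real.sq_sqrt (Nat.cast_nonneg d), inv_pow]
    calc _ ≤ d * nsq (GradOp (fine N M) (N : ℂ) *ᵥ ψ) / (N : ℝ) ^ 2 :=
          (le_div_iff₀ (pow_pos hN 2)).mpr (by rw [mul_comm]; exact h)
      _ = _ := by ring
  calc _ ≤ Real.sqrt ((Real.sqrt d * (N : ℝ)⁻¹) ^ 2 * nsq (GradOp (fine N M) (N : ℂ) *ᵥ ψ)) := Real.sqrt_le_sqrt h2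
    _ = _ := by rw [Real.sqrt_mul (sq_nonneg _), Real.sqrt_sq (by positivity)]

/-- B2's pointwise identity as a field identity: `∂′ᴴ(J u) = J₀(∂ᴴu) + ∂′ᴴ(fluxJ u)`. [folklore] -/
theorem gradH_JK_eq (u : Tor (fine N M) × Fin d → ℂ) :
    (GradOp (fine (L * N) M) ((L : ℂ) * (N : ℂ)))ᴴ *ᵥ (JK N L M *ᵥ u)
      = JK0 N L M *ᵥ ((GradOp (fine N M) (N : ℂ))ᴴ *ᵥ u) + (GradOp (fine (L * N) M) ((L : ℂ) * (N : ℂ)))ᴴ *ᵥ fluxJ N L M u := by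
  funext z
  have h := GradOp_conjTranspose_JK_sub_JK0_apply N L M (N : ℂ) u z
  rw [Pi.add_apply, ← h]
  ring

end Defects

/-! ## §3 The representation and the two-level law -/

section Main

variable (N L : ℕ) [NeZero N] [NeZero L] (M : Fin d → ℕ) [hM : ∀ μ, NeZero (M μ)]
variable (W : Matrix (Tor (fine N M)) (Tor (fine N M)) ℂ) (W' : Matrix (Tor (fine (L * N) M)) (Tor (fine (L * N) M)) ℂ)

/-- **THE REPRESENTATION**: with `g = ∂′(Tψ) − J(∂ψ)`, `h = fluxJ (∂ψ)`, `v = (T − J₀)ψ` and `W′J₀ = J₀W`,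
`(∂′ᴴ∂′ + W′)(Tψ) = J₀((∂ᴴ∂ + W)ψ) + ∂′ᴴ(g + h) + W′v`. [folklore] -/
theorem fine_taylor_identity (hWJ : W' * JK0 N L M = JK0 N L M * W) (ψ : Tor (fine N M) → ℂ) :
    ((GradOp (fine (L * N) M) ((L : ℂ) * (N : ℂ)))ᴴ * GradOp (fine (L * N) M) ((L : ℂ) * (N : ℂ)) + W') *ᵥ (taylorJ N L M *ᵥ ψ)
      = JK0 N L M *ᵥ (((GradOp (fine N M) (N : ℂ))ᴴ * GradOp (fine N M) (N : ℂ) + W) *ᵥ ψ)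
        + (GradOp (fine (L * N) M) ((L : ℂ) * (N : ℂ)))ᴴ *ᵥ
            ((GradOp (fine (L * N) M) ((L : ℂ) * (N : ℂ)) *ᵥ (taylorJ N L M *ᵥ ψ) - JK N L M *ᵥ (GradOp (fine N M) (N : ℂ) *ᵥ ψ))
              + fluxJ N L M (GradOp (fine N M) (N : ℂ) *ᵥ ψ))
        + W' *ᵥ ((taylorJ N L M - JK0 N L M) *ᵥ ψ) := by
  have hflux := gradH_JK_eq N L M (GradOp (fine N M) (N : ℂ) *ᵥ ψ)
  have hW : W' *ᵥ (JK0 N L M *ᵥ ψ) = JK0 N L M *ᵥ (W *ᵥ ψ) := by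
    rw [Matrix.mulVec_mulVec, Matrix.mulVec_mulVec, hWJ]
  simp only [Matrix.add_mulVec, Matrix.sub_mulVec, Matrix.mulVec_add, Matrix.mulVec_sub, ← Matrix.mulVec_mulVec]
  rw [hflux, hW]
  abel

/-- the constant of the torus two-level law for the gradient of the massive scalar solution. [folklore] -/
def Ccol (d L : ℕ) (g g' w w' : ℝ) : ℝ :=
  (2 * Real.sqrt d * L + 1) * (1 + w * g) + Real.sqrt g' * w' * (Real.sqrt d * Real.sqrt g)

omit [NeZero L] in
/-- `0 ≤ Ccol`. [folklore] -/
theorem Ccol_nonneg {g g' w w' : ℝ} (hg : 0 ≤ g) (hw : 0 ≤ w) (hw' : 0 ≤ w') : 0 ≤ Ccol d L g g' w w' := by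
  unfold Ccol; positivity

/-- **THE TORUS TWO-LEVEL LAW FOR THE GRADIENT OF THE MASSIVE SCALAR SOLUTION WITH PLANTED DATA** (route «H⁻¹», no wall):
for `D = ∂ᴴ∂ + W`, `D′ = ∂′ᴴ∂′ + W′`, `W, W′ ⪰ 0`, `W′J₀ = J₀W`, `DG = 1`, `D′G′ = G′D′ = 1`,
`‖∂′(G′(J₀f)) − J(∂(Gf))‖ ≤ Ccol·N⁻¹·‖f‖`. [folklore] -/
theorem sqrt_nsq_columns_twoLevel_le {G : Matrix (Tor (fine N M)) (Tor (fine N M)) ℂ}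
    {G' : Matrix (Tor (fine (L * N) M)) (Tor (fine (L * N) M)) ℂ} {g g' w w' : ℝ} (hw : 0 ≤ w) (hw' : 0 ≤ w')
    (hWJ : W' * JK0 N L M = JK0 N L M * W) (hWpos0 : ∀ v, 0 ≤ (star v ⬝ᵥ (W *ᵥ v)).re)
    (hWpos : ∀ v, 0 ≤ (star v ⬝ᵥ (W' *ᵥ v)).re)
    (hDG : ((GradOp (fine N M) (N : ℂ))ᴴ * GradOp (fine N M) (N : ℂ) + W) * G = 1)
    (hD'G' : ((GradOp (fine (L * N) M) ((L : ℂ) * (N : ℂ)))ᴴ * GradOp (fine (L * N) M) ((L : ℂ) * (N : ℂ)) + W') * G' = 1)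
    (hG'D' : G' * ((GradOp (fine (L * N) M) ((L : ℂ) * (N : ℂ)))ᴴ * GradOp (fine (L * N) M) ((L : ℂ) * (N : ℂ)) + W') = 1)
    (hGn : ‖G‖ ≤ g) (hG'n : ‖G'‖ ≤ g') (hWn : ‖W‖ ≤ w) (hW'n : ‖W'‖ ≤ w') (f : Tor (fine N M) → ℂ) :
    Real.sqrt (nsq (GradOp (fine (L * N) M) ((L : ℂ) * (N : ℂ)) *ᵥ (G' *ᵥ (JK0 N L M *ᵥ f))
        - JK N L M *ᵥ (GradOp (fine N M) (N : ℂ) *ᵥ (G *ᵥ f))))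
      ≤ Ccol d L g g' w w' * (N : ℝ)⁻¹ * Real.sqrt (nsq f) := by
  have hN : (0 : ℝ) < N := by exact_mod_cast Nat.pos_of_ne_zero (NeZero.ne N)
  set D1 := GradOp (fine (L * N) M) ((L : ℂ) * (N : ℂ)) with hD1
  set D0 := GradOp (fine N M) (N : ℂ) with hD0
  set ψ := G *ᵥ f with hψ
  set gv := D1 *ᵥ (taylorJ N L M *ᵥ ψ) - JK N L M *ᵥ (D0 *ᵥ ψ) with hgv
  set hv := fluxJ N L M (D0 *ᵥ ψ) with hhv
  set vv := (taylorJ N L M - JK0 N L M) *ᵥ ψ with hvv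
  -- `Dψ = f`
  have hDψ : ((D0ᴴ * D0 + W) *ᵥ ψ) = f := by rw [hψ, Matrix.mulVec_mulVec, hDG, Matrix.one_mulVec]
  -- the representation of the error `e = G′(J₀f) − Tψ`
  have hrep := fine_taylor_identity N L M W W' hWJ ψ
  rw [← hD1, ← hD0, hDψ] at hrep
  rw [← hgv, ← hhv, ← hvv] at hrep
  have he : G' *ᵥ (JK0 N L M *ᵥ f) - taylorJ N L M *ᵥ ψ = -(G' *ᵥ (D1ᴴ *ᵥ (gv + hv) + W' *ᵥ vv)) := by
    have e1 : taylorJ N L M *ᵥ ψ = G' *ᵥ (JK0 N L M *ᵥ f) + G' *ᵥ (D1ᴴ *ᵥ (gv + hv) + W' *ᵥ vv) := by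
      calc taylorJ N L M *ᵥ ψ = (G' * (D1ᴴ * D1 + W')) *ᵥ (taylorJ N L M *ᵥ ψ) := by rw [hG'D', Matrix.one_mulVec]
        _ = G' *ᵥ ((D1ᴴ * D1 + W') *ᵥ (taylorJ N L M *ᵥ ψ)) := (Matrix.mulVec_mulVec _ _ _).symm
        _ = G' *ᵥ (JK0 N L M *ᵥ f) + G' *ᵥ (D1ᴴ *ᵥ (gv + hv) + W' *ᵥ vv) := by
            rw [hrep]; simp only [Matrix.mulVec_add]; abel
    rw [e1]
    abel
  -- the gradient of the error
  have hmain : D1 *ᵥ (G' *ᵥ (JK0 N L M *ᵥ f)) - JK N L M *ᵥ (D0 *ᵥ ψ)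
      = gv - D1 *ᵥ (G' *ᵥ (D1ᴴ *ᵥ (gv + hv))) - D1 *ᵥ (G' *ᵥ (W' *ᵥ vv)) := by
    have e2 : D1 *ᵥ (G' *ᵥ (JK0 N L M *ᵥ f)) = D1 *ᵥ (G' *ᵥ (JK0 N L M *ᵥ f) - taylorJ N L M *ᵥ ψ) + D1 *ᵥ (taylorJ N L M *ᵥ ψ) := by
      rw [Matrix.mulVec_sub, sub_add_cancel]
    rw [e2, he, Matrix.mulVec_neg, Matrix.mulVec_add, Matrix.mulVec_add]
    rw [hgv]
    abel
  -- energy tools for `D′`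
  have hform : ∀ v, nsq (D1 *ᵥ v) ≤ (star v ⬝ᵥ ((D1ᴴ * D1 + W') *ᵥ v)).re := nsq_grad_le_form D1 W' hWpos
  -- the three defects
  have hg1 := sqrt_nsq_gdef_le N L M ψ
  have hh1 := sqrt_nsq_flux_le N L M ψ
  have hv1 := sqrt_nsq_taylor_sub_le N L M ψ
  rw [← hD1, ← hD0, ← hgv] at hg1
  rw [← hD0, ← hhv] at hh1
  rw [← hvv, ← hD0] at hv1
  -- `‖Δψ‖ ≤ (1 + w g)‖f‖`, `‖∂ψ‖ ≤ √g ‖f‖`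
  have hLap : Real.sqrt (nsq (LapS (fine N M) (N : ℂ) *ᵥ ψ)) ≤ (1 + w * g) * Real.sqrt (nsq f) := by
    have e3 : LapS (fine N M) (N : ℂ) *ᵥ ψ = f - W *ᵥ ψ := by
      rw [← GradOp_conjTranspose_mul_GradOp, ← hD0, eq_sub_iff_add_eq, ← Matrix.add_mulVec]; exact hDψ
    rw [e3, add_mul, one_mul]
    refine (sqrt_nsq_sub_le _ _).trans (add_le_add le_rfl ?_)
    rw [hψ, Matrix.mulVec_mulVec]
    refine (sqrt_nsq_mulVec_le _ _).trans (mul_le_mul_of_nonneg_right ?_ (Real.sqrt_nonneg _))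
    exact (Matrix.l2_opNorm_mul _ _).trans (mul_le_mul hWn hGn (norm_nonneg _) hw)
  have hgrad : Real.sqrt (nsq (D0 *ᵥ ψ)) ≤ Real.sqrt g * Real.sqrt (nsq f) := by
    have hform0 : ∀ v, nsq (D0 *ᵥ v) ≤ (star v ⬝ᵥ ((D0ᴴ * D0 + W) *ᵥ v)).re := nsq_grad_le_form D0 W hWpos0
    rw [hψ]
    exact (sqrt_nsq_grad_inv_le D0 hDG hform0 f).trans
      (mul_le_mul_of_nonneg_right (Real.sqrt_le_sqrt hGn) (Real.sqrt_nonneg _))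
  -- nonnegativity bookkeeping
  have h0f : 0 ≤ Real.sqrt (nsq f) := Real.sqrt_nonneg _
  have hΛ0 : 0 ≤ Real.sqrt (nsq (LapS (fine N M) (N : ℂ) *ᵥ ψ)) := Real.sqrt_nonneg _
  have hN0 : 0 ≤ (N : ℝ)⁻¹ := inv_nonneg.mpr hN.le
  have hd0 : 0 ≤ Real.sqrt (d : ℝ) := Real.sqrt_nonneg _
  -- the three pieces of the gradient of the error
  have p1 : Real.sqrt (nsq (D1 *ᵥ (G' *ᵥ (D1ᴴ *ᵥ (gv + hv))))) ≤ Real.sqrt (nsq gv) + Real.sqrt (nsq hv) :=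
    (sqrt_nsq_grad_inv_gradH_le D1 hD'G' hform (gv + hv)).trans (sqrt_nsq_add_le _ _)
  have p2 : Real.sqrt (nsq (D1 *ᵥ (G' *ᵥ (W' *ᵥ vv)))) ≤ Real.sqrt g' * (w' * Real.sqrt (nsq vv)) := by
    refine (sqrt_nsq_grad_inv_le D1 hD'G' hform (W' *ᵥ vv)).trans ?_
    exact mul_le_mul (Real.sqrt_le_sqrt hG'n) ((sqrt_nsq_mulVec_le _ _).trans
      (mul_le_mul_of_nonneg_right hW'n (Real.sqrt_nonneg _))) (Real.sqrt_nonneg _) (Real.sqrt_nonneg _)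
  rw [hmain]
  calc Real.sqrt (nsq (gv - D1 *ᵥ (G' *ᵥ (D1ᴴ *ᵥ (gv + hv))) - D1 *ᵥ (G' *ᵥ (W' *ᵥ vv))))
      ≤ Real.sqrt (nsq gv) + Real.sqrt (nsq (D1 *ᵥ (G' *ᵥ (D1ᴴ *ᵥ (gv + hv)))))
          + Real.sqrt (nsq (D1 *ᵥ (G' *ᵥ (W' *ᵥ vv)))) :=
        (sqrt_nsq_sub_le _ _).trans (add_le_add (sqrt_nsq_sub_le _ _) le_rfl)
    _ ≤ Real.sqrt (nsq gv) + (Real.sqrt (nsq gv) + Real.sqrt (nsq hv)) + Real.sqrt g' * (w' * Real.sqrt (nsq vv)) := by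
        gcongr
    _ ≤ Real.sqrt d * L * (N : ℝ)⁻¹ * Real.sqrt (nsq (LapS (fine N M) (N : ℂ) *ᵥ ψ))
          + (Real.sqrt d * L * (N : ℝ)⁻¹ * Real.sqrt (nsq (LapS (fine N M) (N : ℂ) *ᵥ ψ))
            + (N : ℝ)⁻¹ * Real.sqrt (nsq (LapS (fine N M) (N : ℂ) *ᵥ ψ)))
          + Real.sqrt g' * (w' * (Real.sqrt d * (N : ℝ)⁻¹ * Real.sqrt (nsq (D0 *ᵥ ψ)))) := by
        gcongr
    _ ≤ Real.sqrt d * L * (N : ℝ)⁻¹ * ((1 + w * g) * Real.sqrt (nsq f))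
          + (Real.sqrt d * L * (N : ℝ)⁻¹ * ((1 + w * g) * Real.sqrt (nsq f))
            + (N : ℝ)⁻¹ * ((1 + w * g) * Real.sqrt (nsq f)))
          + Real.sqrt g' * (w' * (Real.sqrt d * (N : ℝ)⁻¹ * (Real.sqrt g * Real.sqrt (nsq f)))) := by
        gcongr
    _ = Ccol d L g g' w w' * (N : ℝ)⁻¹ * Real.sqrt (nsq f) := by unfold Ccol; ring

/-- **OPERATOR FORM**: `‖∂′·G′·J₀ − J·(∂·G)‖ ≤ Ccol·N⁻¹`. [folklore] -/
theorem opNorm_columns_twoLevel_le {G : Matrix (Tor (fine N M)) (Tor (fine N M)) ℂ}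
    {G' : Matrix (Tor (fine (L * N) M)) (Tor (fine (L * N) M)) ℂ} {g g' w w' : ℝ}
    (hg : 0 ≤ g) (hw : 0 ≤ w) (hw' : 0 ≤ w')
    (hWJ : W' * JK0 N L M = JK0 N L M * W) (hWpos0 : ∀ v, 0 ≤ (star v ⬝ᵥ (W *ᵥ v)).re)
    (hWpos : ∀ v, 0 ≤ (star v ⬝ᵥ (W' *ᵥ v)).re)
    (hDG : ((GradOp (fine N M) (N : ℂ))ᴴ * GradOp (fine N M) (N : ℂ) + W) * G = 1)
    (hD'G' : ((GradOp (fine (L * N) M) ((L : ℂ) * (N : ℂ)))ᴴ * GradOp (fine (L * N) M) ((L : ℂ) * (N : ℂ)) + W') * G' = 1)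
    (hG'D' : G' * ((GradOp (fine (L * N) M) ((L : ℂ) * (N : ℂ)))ᴴ * GradOp (fine (L * N) M) ((L : ℂ) * (N : ℂ)) + W') = 1)
    (hGn : ‖G‖ ≤ g) (hG'n : ‖G'‖ ≤ g') (hWn : ‖W‖ ≤ w) (hW'n : ‖W'‖ ≤ w') :
    ‖GradOp (fine (L * N) M) ((L : ℂ) * (N : ℂ)) * G' * JK0 N L M - JK N L M * (GradOp (fine N M) (N : ℂ) * G)‖
      ≤ Ccol d L g g' w w' * (N : ℝ)⁻¹ := by
  have hN : (0 : ℝ) < N := by exact_mod_cast Nat.pos_of_ne_zero (NeZero.ne N)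
  have hC : 0 ≤ Ccol d L g g' w w' * (N : ℝ)⁻¹ := mul_nonneg (Ccol_nonneg L hg hw hw') (inv_nonneg.mpr hN.le)
  refine opNorm_le_of_nsq_le_rect _ hC fun f => ?_
  have h := sqrt_nsq_columns_twoLevel_le N L M W W' hw hw' hWJ hWpos0 hWpos hDG hD'G' hG'D' hGn hG'n hWn hW'n f
  have e : (GradOp (fine (L * N) M) ((L : ℂ) * (N : ℂ)) * G' * JK0 N L M - JK N L M * (GradOp (fine N M) (N : ℂ) * G)) *ᵥ f
      = GradOp (fine (L * N) M) ((L : ℂ) * (N : ℂ)) *ᵥ (G' *ᵥ (JK0 N L M *ᵥ f))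
        - JK N L M *ᵥ (GradOp (fine N M) (N : ℂ) *ᵥ (G *ᵥ f)) := by
    rw [Matrix.sub_mulVec, ← Matrix.mulVec_mulVec, ← Matrix.mulVec_mulVec, ← Matrix.mulVec_mulVec, ← Matrix.mulVec_mulVec]
  rw [e]
  have h2 := mul_self_le_mul_self (Real.sqrt_nonneg _) h
  rw [Real.mul_self_sqrt (nsq_nonneg _), mul_mul_mul_comm, Real.mul_self_sqrt (nsq_nonneg _), ← sq] at h2
  exact h2

end Main

end Summit.QuantumFields.BalabanUV.T4Continuum.TorusColumnsTwoLevel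

end
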